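/-
Copyright (c) 2026 the pub-hodgecm-mathlib formalisation cell (harness21).  Prover seat hodgecm-mathlib-K2E1-p13 (g3), Track B ∕ K2-LIT, h413 = `stmt-HodgeConjecture-24833`,
line `K2_E1_TraceFormulaBeta`, route of record `HCCMUnconditional`; dealer K2E1-plan (g7) (267)∕(268) AMENDMENT #3 G7 HEAD: `hconj` at a `c_G`-stable finite-index level with the
realness-of-bases letters DISCHARGED (★ `K2E1ChiSectionRealBasisU2`), leaving ONLY the level letter `c_G(K′) ⊆ K′` (and the `K′`-type compatibility).
-/
import Summits.HodgeConjecture.HodgeConjecture.Theorems.K2E1ChiScatteringConjSymmetryLevelCMTwo   -- ★ p860859 (this seat): §2 `matrix_conj_of_real_of_poleSet` (generic), §3 CM print on reps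
import Summits.HodgeConjecture.HodgeConjecture.Theorems.K2E1ChiSectionRealBasisU2               -- ★ (this seat): `exists_real_basis_chiSectionSpace_cm`
import HarnessLib

/-!
# K2·E1 — `K2E1ChiScatteringConjSymmetryLevelCMTwoFinal`: THE G7 HEAD — for a SELF-DUAL UNITARY `χ` of `U(1,1)_{L∕L⁺}` and a `c_G`-stable finite-index level `K′`, there are `c_G`-REAL
# bases of `V(χ, K′, ω)` and `V(χʷ, K′, ω)` in which EVERY continued scattering package satisfies `qc_{ij}(conj z) = conj qc_{ij}(z)` off `P ∪ conj P`

Track B ∕ K2-LIT, crux h413 = `stmt-HodgeConjecture-24833`; cell `hodgecm-mathlib`, squad K2, ENGINE E1, AMENDMENT #3 «GENERAL (U,τ) LADDER» G7 (`hconj ⇒ hadj` at `𝔫̄ = 𝔫` levels; consumers: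
G6 general `hreal ∧ hs` through ★ p860605's per-coordinate `hconj` letter, G8 `hadj`, K2-defs1's G3 exports which take the basis `bV` of `V(χʷ, K′, ω)` as INPUT — choose `bV := b′` below).
THEOREMS ONLY (no `def`, no `instance`, no notation, no named-fact hypothesis, no `sorry`; default heartbeats); lane `--kind proof --supports stmt-HodgeConjecture-24833 --as helper`
(count-neutral).  Closes no socket.

THE MATHEMATICS ([MoeglinWaldspurger1995, I.2.17, II.1.7, IV.1.10]; [Langlands1976, §7]; [GelbartRogawski1991, §3.1]).  ★ `matrix_conj_of_real_of_poleSet` gives the entrywise reflection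
symmetry of the continued scattering coordinates in `c_G`-REAL bases; ★ `exists_real_basis_chiSectionSpace_cm` provides such bases of `V(χ, K′, ω)` and `V(χʷ, K′, ω)` (`χʷ = χ` is again
self-dual unitary) whenever `χ` is self-dual unitary, `K′` is `c_G`-stable of finite index in `K_max` and the `K′`-type satisfies `conj ω = ω ∘ c_G`.  RESULT
**`chi_scattering_matrix_conj_symm_level_final_cm_two`**: under exactly these hypotheses, `∃` real bases `b` (of `V(χ, K′, ω)`) and `b′` (of `V(χʷ, K′, ω)`) such that for EVERY package
`(q, qc, P)` with the X2_χ clause shapes written in these bases (`Σ_j q_{ij}(z)·b′_j = (ν𝓕)⁻¹·φ̃^{b_i}_z·H^{z−1}` on the tube, `qc = q` there, `P` closed co-discrete `⊆ {Re ≤ 1}`, `qc_{ij}`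
analytic off `P`): `qc_{ij}(conj z) = conj qc_{ij}(z)` off `P ∪ conj P`.  The ONLY letters left are the level letter `hK : c_G(K′) ⊆ K′` (for `K′ = K_∞·K_f(𝔫)`: `𝔫̄ = 𝔫`, item (N1))
and `hω` (vacuous for `ω = 1`).  At `K′ = K_max`, `ω = 1` this recovers ★ p860445 (rank one).
HONEST LABEL: HC_CM is proved only modulo the 7 printed citations (2 remaining named inputs: hLiu418 = `stmt-HodgeConjecture-24832`, h413 = `stmt-HodgeConjecture-24833`) until rung 0
closes; this file asserts no named fact and closes no socket; count-neutral; hypothesis-first on `hK`, `hω`, `hfi`.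

## References
* [MoeglinWaldspurger1995] C. Mœglin, J.-L. Waldspurger, *Spectral decomposition and Eisenstein series* (1995), I.2.17, II.1.7, IV.1.10.
* [Langlands1976] R. P. Langlands, *On the Functional Equations Satisfied by Eisenstein Series*, LNM 544 (1976), §7.
* [GelbartRogawski1991] S. Gelbart, J. Rogawski, *L-functions and Fourier–Jacobi coefficients for the unitary group U(3)*, Invent. Math. 105 (1991), §3.1.
-/

set_option autoImplicit false
set_option linter.dupNamespace false  -- the mandated namespace repeats the summit's segment (`HodgeConjecture.HodgeConjecture`)

noncomputable section

open MeasureTheory Measure Set NumberField IsDedekindDomain Filter Topology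
open scoped NNReal ComplexConjugate
open Literature.NumberTheory.Automorphic Literature.NumberTheory.Automorphic.UnitaryGroup AdelicGroupData
open Literature.NumberTheory.GaloisRepresentations (HeckeCharacter)
open Summit.HodgeConjecture.HodgeConjecture.Cruxes.H413.K2E1BorelEisensteinU
open Summit.HodgeConjecture.HodgeConjecture.Cruxes.H413.K2E1CharacterEisensteinU2Defs
open Summit.HodgeConjecture.HodgeConjecture.Cruxes.H413.K2E1ChiSectionSpaceU2Defs
open Summit.HodgeConjecture.HodgeConjecture.Cruxes.H413.K2E1ChiScatteringConjSymmetryLevelCMTwo (matrix_conj_of_real_of_poleSet)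
open Summit.HodgeConjecture.HodgeConjecture.Cruxes.H413.K2E1ChiSectionRealBasisU2 (exists_real_basis_chiSectionSpace_cm)

namespace Summit.HodgeConjecture.HodgeConjecture.Cruxes.H413.K2E1ChiScatteringConjSymmetryLevelCMTwoFinal

variable (L : Type) [Field L] [NumberField L] [IsCMField L]
variable [MeasurableSpace (quasiSplit (↥(maximalRealSubfield L)) L (IsCMField.complexConj L) 2).Adelic] [BorelSpace (quasiSplit (↥(maximalRealSubfield L)) L (IsCMField.complexConj L) 2).Adelic]

/-- **G7 HEAD — `hconj` AT A `c_G`-STABLE FINITE-INDEX LEVEL, BASES DISCHARGED** (module docstring): for `χ` self-dual unitary, `K′` with `[K_max : K′ ∩ K_max] < ∞`, `c_G(K′) ⊆ K′` and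
`conj ω = ω ∘ c_G`, there are `c_G`-real bases `b` of `V(χ, K′, ω)`, `b′` of `V(χʷ, K′, ω)` such that EVERY continued package written in them has `qc_{ij}(conj z) = conj qc_{ij}(z)` off
`P ∪ conj P`. [cite: MoeglinWaldspurger1995, II.1.7, IV.1.10] [cite: Langlands1976, §7] [cite: GelbartRogawski1991, §3.1] -/
theorem chi_scattering_matrix_conj_symm_level_final_cm_two
    {cG : (quasiSplit (↥(maximalRealSubfield L)) L (IsCMField.complexConj L) 2).Adelic →* (quasiSplit (↥(maximalRealSubfield L)) L (IsCMField.complexConj L) 2).Adelic}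
    (hcG : ∀ g, adelicVal (↥(maximalRealSubfield L)) L (IsCMField.complexConj L) 2 _ (cG g) =
      Matrix.GeneralLinearGroup.map (conjAdele (↥(maximalRealSubfield L)) L (IsCMField.complexConj L)) (adelicVal (↥(maximalRealSubfield L)) L (IsCMField.complexConj L) 2 _ g))
    (ν : Measure ↥(adelicUnipotent (↥(maximalRealSubfield L)) L (IsCMField.complexConj L) 2)) [ν.IsInvInvariant] (𝓕 : Set ↥(adelicUnipotent (↥(maximalRealSubfield L)) L (IsCMField.complexConj L) 2))
    (K' : Subgroup (quasiSplit (↥(maximalRealSubfield L)) L (IsCMField.complexConj L) 2).Adelic) (hfi : (K'.subgroupOf ((standardMaximalCompactGL 2 L).comap (adelicVal (↥(maximalRealSubfield L)) L (IsCMField.complexConj L) 2 ((StdForm.antidiagonal 2).over L)) : Subgroup (quasiSplit (↥(maximalRealSubfield L)) L (IsCMField.complexConj L) 2).Adelic)).FiniteIndex)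
    (hK : ∀ k : ↥K', cG (k : (quasiSplit (↥(maximalRealSubfield L)) L (IsCMField.complexConj L) 2).Adelic) ∈ K')
    {ω : ↥K' → ℂ} (hω : ∀ k : ↥K', conj (ω k) = ω ⟨cG (k : (quasiSplit (↥(maximalRealSubfield L)) L (IsCMField.complexConj L) 2).Adelic), hK k⟩)
    {χ : HeckeCharacter L} (hsd : reflectChar (IsCMField.complexConj L) χ = χ) (hχ : χ.IsUnitary) :
    ∃ (n n' : ℕ) (b : Module.Basis (Fin n) ℂ ↥(chiSectionSpace χ K' ω)) (b' : Module.Basis (Fin n') ℂ ↥(chiSectionSpace (reflectChar (IsCMField.complexConj L) χ) K' ω)),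
      (∀ i g, conj ((b i : (quasiSplit (↥(maximalRealSubfield L)) L (IsCMField.complexConj L) 2).Adelic → ℂ) g) = (b i : (quasiSplit (↥(maximalRealSubfield L)) L (IsCMField.complexConj L) 2).Adelic → ℂ) (cG g)) ∧
      (∀ j g, conj ((b' j : (quasiSplit (↥(maximalRealSubfield L)) L (IsCMField.complexConj L) 2).Adelic → ℂ) g) = (b' j : (quasiSplit (↥(maximalRealSubfield L)) L (IsCMField.complexConj L) 2).Adelic → ℂ) (cG g)) ∧
      ∀ {q qc : Fin n → Fin n' → ℂ → ℂ} {P : Set ℂ},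
        (∀ i (z : ℂ), 1 < z.re → (∑ j, q i j z • (b' j : (quasiSplit (↥(maximalRealSubfield L)) L (IsCMField.complexConj L) 2).Adelic → ℂ)) = ((((ν 𝓕).toReal⁻¹ : ℝ)) : ℂ) • (fun g : (quasiSplit (↥(maximalRealSubfield L)) L (IsCMField.complexConj L) 2).Adelic => (∫ v : ↥(adelicUnipotent (↥(maximalRealSubfield L)) L (IsCMField.complexConj L) 2), flatSectionU (b i : (quasiSplit (↥(maximalRealSubfield L)) L (IsCMField.complexConj L) 2).Adelic → ℂ) z ((quasiSplit (↥(maximalRealSubfield L)) L (IsCMField.complexConj L) 2).toAdelic (weylLongU ((IsCMField.complexConj L : L ≃ₐ[↥(maximalRealSubfield L)] L) : L →+* L) (rfl : (StdForm.antidiagonal 2).over L = (StdForm.antidiagonal 2).over L)) * ((v : (quasiSplit (↥(maximalRealSubfield L)) L (IsCMField.complexConj L) 2).Adelic) * g)) ∂ν) * (((borelHeight g : ℝ) : ℂ) ^ (z - 1)))) →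
        (∀ i j (z : ℂ), 1 < z.re → qc i j z = q i j z) →
        IsClosed P → (∀ z₀ : ℂ, ∀ᶠ s in 𝓝[≠] z₀, s ∉ P) → (∀ z ∈ P, z.re ≤ 1) → (∀ i j (z : ℂ), z ∉ P → AnalyticAt ℂ (qc i j) z) →
        ∀ i j (z : ℂ), z ∉ P → conj z ∉ P → qc i j (conj z) = conj (qc i j z) := by
  have hc : IsCMField.complexConj L * IsCMField.complexConj L = 1 := AlgEquiv.ext fun x => IsCMField.complexConj_apply_apply L x
  have hsd' : reflectChar (IsCMField.complexConj L) (reflectChar (IsCMField.complexConj L) χ) = reflectChar (IsCMField.complexConj L) χ := by rw [hsd, hsd]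
  have hχ' : (reflectChar (IsCMField.complexConj L) χ).IsUnitary := by rw [hsd]; exact hχ
  obtain ⟨n, b, hb⟩ := exists_real_basis_chiSectionSpace_cm L hcG K' hfi hK hω hsd hχ
  obtain ⟨n', b', hb'⟩ := exists_real_basis_chiSectionSpace_cm L hcG K' hfi hK hω hsd' hχ'
  have hli : LinearIndependent ℂ (fun j => (b' j : (quasiSplit (↥(maximalRealSubfield L)) L (IsCMField.complexConj L) 2).Adelic → ℂ)) := b'.linearIndependent.map' (Submodule.subtype _) (Submodule.ker_subtype _)
  refine ⟨n, n', b, b', hb, hb', fun hqφ hqcq hPc hPcd hPre hqa => ?_⟩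
  exact matrix_conj_of_real_of_poleSet hc hcG ν ((ν 𝓕).toReal⁻¹) hb hb' hli hqφ hqcq hPc hPcd hPre hqa

end Summit.HodgeConjecture.HodgeConjecture.Cruxes.H413.K2E1ChiScatteringConjSymmetryLevelCMTwoFinal

end
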